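import Mathlib.Analysis.Complex.BorelCaratheodory
import Literature.NumberTheory.LFunctions.RHInvZetaBound
import Literature.NumberTheory.LFunctions.SiegelExceptionalZeroBound
import Literature.NumberTheory.LFunctions.DirichletLFunctionBounds
import Literature.NumberTheory.LFunctions.ZetaClassicalRegionBounds
import Literature.NumberTheory.LFunctions.LFDSingleDetect
import HarnessLib

/-!
# `1/L(s, χ)` in a zero-free disc at the edge of the critical strip (Borel–Carathéodory)

Topic `Literature/NumberTheory/LFunctions`. Everything in this file is PROVED.

The classical mechanism (Titchmarsh, *The Theory of the Riemann Zeta-Function*, §3.9–§3.11 and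
§14.2; Montgomery–Vaughan, *Multiplicative Number Theory I*, §6.2 Lemma 6.3) turning a ZERO-FREE
region into an upper bound for `1/L(s, χ)`, in the "Linnik box" geometry where the zero-free
abscissa `1 − η` may be MUCH wider than the classical `1 − c/log qT` (so that `η log q` is not
bounded): let `χ ≠ χ₀` be a Dirichlet character mod `q`, `0 < η ≤ 1/4`, `0 < a ≤ 1`, `t ∈ ℝ`, put
`s₀ = 1 + aη + it`, `R = (1 + a)η`, and assume `L(w, χ) ≠ 0` for `‖w − s₀‖ < R`, `Re w < 1`
(for `Re w ≥ 1` this is Mathlib's non-vanishing). Then for `‖s − s₀‖ = d < R`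

`‖L(s, χ)⁻¹‖ ≤ exp( 2 M d/(R − d) + (log(2/(aη)) + π)(R + d)/(R − d) )`,
`M = 2 + η log q + log(|t| + 2) + log(log q + 5)`

(`InvLFunctionDisc.norm_inv_LFunction_le_exp`). Proof: `log ‖L(w, χ)‖ ≤ M` on the disc (hybrid
partial summation bound `‖L(w,χ)‖ ≤ q^δ ‖w‖ ∑ n^{-(Re w + δ)}`, tree
`Siegel.norm_LFunction_le_rpow`, with `δ = η + 1/(log q + 4)`); a holomorphic logarithm `Lg` of
`L(·, χ)` on the disc (`InvZetaRH.exists_log_of_ball`); Borel–Carathéodory (Mathlib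
`Complex.borelCaratheodory`) for `z ↦ Lg(s₀ + z)` with `Re Lg = log ‖L‖ ≤ M`; and at the centre
`‖log L(s₀, χ)‖ ≤ |log ‖L(s₀, χ)‖| + π ≤ log(2/(aη)) + π`, because
`aη/2 ≤ (σ₀−1)/σ₀ ≤ ‖L(s₀, χ)‖ ≤ σ₀/(σ₀ − 1) ≤ 2/(aη)` (`σ₀ = 1 + aη`). The second summand is thus free
of `q` and `t`, which is what makes the bound useful on contours passing at distance `≍ η` from
`s₀` (`norm_inv_LFunction_le_exp_of_line`: on the horizontal line through `s₀`,
`‖L(σ + it, χ)⁻¹‖ ≤ exp(4M(1 + aη − σ)/η + 4(log(2/(aη)) + π))` for `1 − η/2 ≤ σ ≤ 1 + aη`, `a ≤ 1/4`).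

## References

* [Titchmarsh1986] E. C. Titchmarsh, *The Theory of the Riemann Zeta-Function*, 2nd ed. (1986),
  §3.9 Lemma, §3.11, §14.2 (14.2.2).
* [MontgomeryVaughan2007] H. L. Montgomery, R. C. Vaughan, *Multiplicative Number Theory I*,
  CUP 2007, §6.2 (Lemma 6.3, Borel–Carathéodory), §11.1.
* [IwaniecKowalski2004] H. Iwaniec, E. Kowalski, *Analytic Number Theory*, AMS 2004, §5.4, §18.2
  (Linnik's use of wide zero-free boxes).
-/

noncomputable section

open Complex Filter Topology Metric Set

namespace Literature.NumberTheory.LFunctions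

namespace InvLFunctionDisc

variable {q : ℕ} [NeZero q] (χ : DirichletCharacter ℂ q)

/-- **`L(w, χ)` just to the left of `1`, hybrid form.** For `χ ≠ χ₀` mod `q`, `0 < η ≤ 1/4` and
`Re w > 1 − η`: `‖L(w, χ)‖ ≤ e · q^η · ‖w‖ · (log q + 5)` (the tree's
`Siegel.norm_LFunction_le_rpow` with `δ = η + 1/(log q + 4)`, `q^{1/(log q + 4)} ≤ e`,
`∑_{n ≥ 1} n^{-1-1/ℓ} ≤ ℓ + 1`). [cite: MontgomeryVaughan2007, §10.2 Lemma 10.15] -/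
theorem norm_LFunction_le_hybrid (hχ : χ ≠ 1) {η : ℝ} (hη0 : 0 < η) (hη : η ≤ 1 / 4) {w : ℂ}
    (hw : 1 - η < w.re) :
    ‖χ.LFunction w‖ ≤ Real.exp 1 * (q : ℝ) ^ η * ‖w‖ * (Real.log q + 5) := by
  have hq1 : (1 : ℝ) ≤ q := by exact_mod_cast NeZero.one_le
  have hq0 : (0 : ℝ) < q := by linarith
  have hlogq : 0 ≤ Real.log q := Real.log_nonneg hq1
  set ℓ : ℝ := Real.log q + 4 with hℓ
  have hℓ4 : 4 ≤ ℓ := by rw [hℓ]; linarith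
  have hℓ0 : 0 < ℓ := by linarith
  set δ : ℝ := η + 1 / ℓ with hδ
  have h1ℓ : 1 / ℓ ≤ 1 / 4 := by
    rw [div_le_div_iff₀ hℓ0 (by norm_num : (0 : ℝ) < 4)]; linarith
  have h1ℓ0 : 0 < 1 / ℓ := by positivity
  have hδ0 : 0 ≤ δ := by rw [hδ]; linarith
  have hδ1 : δ ≤ 1 := by rw [hδ]; linarith
  have hw0 : 0 < w.re := by linarith
  have hwδ : 1 < w.re + δ := by rw [hδ]; linarith
  have h := Siegel.norm_LFunction_le_rpow χ hχ hδ0 hδ1 hw0 hwδ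
  -- the sum
  have hω : 1 < 1 + 1 / ℓ := by linarith
  have hZ1 : Summable fun n : ℕ ↦ ((n + 1 : ℕ) : ℝ) ^ (-(1 + 1 / ℓ)) := by
    have := DirichletAbel.summable_rpow_neg (σ := 1 / ℓ) h1ℓ0
    convert this using 2; ring_nf
  have hZw : Summable fun n : ℕ ↦ ((n + 1 : ℕ) : ℝ) ^ (-(w.re + δ)) := by
    have := DirichletAbel.summable_rpow_neg (σ := w.re + δ - 1) (by linarith)
    convert this using 2; ring_nf
  have hsum : ∑' n : ℕ, ((n + 1 : ℕ) : ℝ) ^ (-(w.re + δ)) ≤ Real.log q + 5 := by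
    have h1 : ∑' n : ℕ, ((n + 1 : ℕ) : ℝ) ^ (-(w.re + δ)) ≤
        ∑' n : ℕ, ((n + 1 : ℕ) : ℝ) ^ (-(1 + 1 / ℓ)) := by
      refine Summable.tsum_le_tsum (fun n ↦ ?_) hZw hZ1
      have hn1 : (1 : ℝ) ≤ ((n + 1 : ℕ) : ℝ) := by exact_mod_cast Nat.le_add_left 1 n
      exact Real.rpow_le_rpow_of_exponent_le hn1 (by rw [hδ]; linarith)
    have h2 : ∑' n : ℕ, ((n + 1 : ℕ) : ℝ) ^ (-(1 + 1 / ℓ)) ≤ (1 + 1 / ℓ) / (1 + 1 / ℓ - 1) :=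
      LFDSingle.tsum_succ_rpow_neg_le hω
    have h3 : (1 + 1 / ℓ) / (1 + 1 / ℓ - 1) = ℓ + 1 := by field_simp; ring
    rw [h3, hℓ] at h2
    linarith
  -- `q^δ ≤ e q^η`
  have hqδ : (q : ℝ) ^ δ ≤ Real.exp 1 * (q : ℝ) ^ η := by
    rw [hδ, Real.rpow_add hq0, mul_comm]
    refine mul_le_mul_of_nonneg_right ?_ (Real.rpow_nonneg hq0.le _)
    rw [Real.rpow_def_of_pos hq0, Real.exp_le_exp]
    calc Real.log q * (1 / ℓ) = Real.log q / ℓ := by ring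
      _ ≤ 1 := by rw [div_le_one hℓ0, hℓ]; linarith
  have hZ0 : 0 ≤ ∑' n : ℕ, ((n + 1 : ℕ) : ℝ) ^ (-(w.re + δ)) := tsum_nonneg fun n ↦ by positivity
  calc ‖χ.LFunction w‖ ≤ (q : ℝ) ^ δ * ‖w‖ * ∑' n : ℕ, ((n + 1 : ℕ) : ℝ) ^ (-(w.re + δ)) := h
    _ ≤ (Real.exp 1 * (q : ℝ) ^ η) * ‖w‖ * (Real.log q + 5) := by gcongr
    _ = Real.exp 1 * (q : ℝ) ^ η * ‖w‖ * (Real.log q + 5) := by ring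

/-- **Two-sided control at the auxiliary centre.** For `Re s > 1`:
`|log ‖L(s, χ)‖| ≤ log(σ/(σ − 1))`, since `(σ−1)/σ ≤ ‖L(s,χ)‖ ≤ σ/(σ−1)` (tree
`DirichletZFR.norm_LFunction_ge`, `ZetaClassicalRegion.norm_LSeries_le_of_norm_le_one`).
[cite: MontgomeryVaughan2007, Lemma 11.1 (proof)] -/
theorem abs_log_norm_LFunction_le {s : ℂ} (hs : 1 < s.re) :
    |Real.log ‖χ.LFunction s‖| ≤ Real.log (s.re / (s.re - 1)) := by
  have hσ0 : 0 < s.re := by linarith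
  have hσ1 : 0 < s.re - 1 := by linarith
  have hlow := DirichletZFR.norm_LFunction_ge χ hs
  have hup : ‖χ.LFunction s‖ ≤ s.re / (s.re - 1) := by
    rw [DirichletCharacter.LFunction_eq_LSeries χ hs]
    exact ZetaClassicalRegion.norm_LSeries_le_of_norm_le_one
      (fun n ↦ DirichletCharacter.norm_le_one χ _) hs
  have hpos : 0 < (s.re - 1) / s.re := by positivity
  have hLpos : 0 < ‖χ.LFunction s‖ := hpos.trans_le hlow
  rw [abs_le]
  constructor
  · have h1 := Real.log_le_log hpos hlow
    have h2 : Real.log ((s.re - 1) / s.re) = -Real.log (s.re / (s.re - 1)) := by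
      rw [← Real.log_inv, inv_div]
    linarith
  · exact Real.log_le_log hLpos hup

/-- Geometry of the disc `‖w − (1 + aη + it)‖ < (1+a)η` (`0 < η ≤ 1/4`, `0 < a ≤ 1`):
`Re w > 1 − η` and `‖w‖ < |t| + 2`. [folklore] -/
theorem re_norm_of_mem_disc {η a t : ℝ} (hη0 : 0 < η) (hη : η ≤ 1 / 4) (ha0 : 0 < a) (ha : a ≤ 1)
    {w : ℂ} (hw : ‖w - (1 + a * η + t * I)‖ < (1 + a) * η) :
    1 - η < w.re ∧ ‖w‖ < |t| + 2 := by
  have h1 := abs_re_le_norm (w - (1 + a * η + t * I))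
  have hre : (w - (1 + a * η + t * I)).re = w.re - (1 + a * η) := by simp
  rw [hre] at h1
  have haη : a * η ≤ 1 / 4 := by nlinarith
  have hR : (1 + a) * η ≤ 1 / 2 := by nlinarith
  constructor
  · have := neg_abs_le (w.re - (1 + a * η))
    nlinarith
  · have hc : ‖(1 + a * η + t * I : ℂ)‖ ≤ |1 + a * η| + |t| := by
      refine (norm_add_le _ _).trans ?_
      have e1 : ‖(1 + a * η : ℂ)‖ = |1 + a * η| := by
        rw [show (1 + a * η : ℂ) = ((1 + a * η : ℝ) : ℂ) by push_cast; ring, Complex.norm_real,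
          Real.norm_eq_abs]
      have e2 : ‖(t * I : ℂ)‖ = |t| := by simp
      rw [e1, e2]
    have habs : |1 + a * η| = 1 + a * η := abs_of_pos (by positivity)
    calc ‖w‖ = ‖(w - (1 + a * η + t * I)) + (1 + a * η + t * I)‖ := by ring_nf
      _ ≤ ‖w - (1 + a * η + t * I)‖ + ‖(1 + a * η + t * I : ℂ)‖ := norm_add_le _ _
      _ < (1 + a) * η + (|1 + a * η| + |t|) := by linarith
      _ ≤ |t| + 2 := by rw [habs]; linarith

/-- **`1/L(s, χ)` in a zero-free disc at the edge of the critical strip (Borel–Carathéodory).**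
Let `χ ≠ χ₀` mod `q`, `0 < η ≤ 1/4`, `0 < a ≤ 1`, `t ∈ ℝ`, `s₀ = 1 + aη + it`, `R = (1+a)η`, and
suppose `L(w, χ) ≠ 0` whenever `‖w − s₀‖ < R` and `Re w < 1`. Then for `‖s − s₀‖ = d < R`,
`‖L(s, χ)⁻¹‖ ≤ exp(2Md/(R − d) + (log(2/(aη)) + π)(R + d)/(R − d))` with
`M = 2 + η log q + log(|t| + 2) + log(log q + 5)`.
[cite: Titchmarsh1986, §3.9 Lemma and §14.2 eq. (14.2.2)] -/
theorem norm_inv_LFunction_le_exp (hχ : χ ≠ 1) {η a t : ℝ} (hη0 : 0 < η) (hη : η ≤ 1 / 4)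
    (ha0 : 0 < a) (ha : a ≤ 1)
    (hzero : ∀ w : ℂ, ‖w - (1 + a * η + t * I)‖ < (1 + a) * η → w.re < 1 → χ.LFunction w ≠ 0)
    {s : ℂ} (hs : ‖s - (1 + a * η + t * I)‖ < (1 + a) * η) :
    ‖(χ.LFunction s)⁻¹‖ ≤ Real.exp
      (2 * (2 + η * Real.log q + Real.log (|t| + 2) + Real.log (Real.log q + 5)) *
          ‖s - (1 + a * η + t * I)‖ / ((1 + a) * η - ‖s - (1 + a * η + t * I)‖) +
        (Real.log (2 / (a * η)) + Real.pi) * ((1 + a) * η + ‖s - (1 + a * η + t * I)‖) /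
          ((1 + a) * η - ‖s - (1 + a * η + t * I)‖)) := by
  have hq1 : (1 : ℝ) ≤ q := by exact_mod_cast NeZero.one_le
  have hq0 : (0 : ℝ) < q := by linarith
  have hlogq : 0 ≤ Real.log q := Real.log_nonneg hq1
  set c : ℂ := 1 + a * η + t * I with hc
  set R : ℝ := (1 + a) * η with hR
  have hR0 : 0 < R := by positivity
  set M : ℝ := 2 + η * Real.log q + Real.log (|t| + 2) + Real.log (Real.log q + 5) with hM
  have hlt2 : 0 < Real.log (|t| + 2) := Real.log_pos (by linarith [abs_nonneg t])
  have hlq5 : 0 < Real.log (Real.log q + 5) := Real.log_pos (by linarith)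
  have hM0 : 0 < M := by have := mul_nonneg hη0.le hlogq; positivity
  -- the disc is zero-free and `L(·, χ)` is holomorphic there
  have hmem : ∀ w ∈ ball c R, ‖w - (1 + a * η + t * I)‖ < (1 + a) * η := fun w hw ↦ by
    rwa [mem_ball, dist_eq_norm] at hw
  have hf0 : ∀ w ∈ ball c R, χ.LFunction w ≠ 0 := by
    intro w hw
    rcases lt_or_ge w.re 1 with h1 | h1
    · exact hzero w (hmem w hw) h1
    · exact DirichletCharacter.LFunction_ne_zero_of_one_le_re χ (Or.inl hχ) h1
  have hf : DifferentiableOn ℂ χ.LFunction (ball c R) :=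
    (DirichletCharacter.differentiable_LFunction hχ).differentiableOn
  obtain ⟨Lg, hLd, hLc, -, hexp⟩ := InvZetaRH.exists_log_of_ball hR0 hf hf0
  -- `Re Lg = log ‖L‖ ≤ M` on the disc
  have hbound : ∀ w ∈ ball c R, ‖χ.LFunction w‖ ≤ Real.exp M := by
    intro w hw
    obtain ⟨hwre, hwn⟩ := re_norm_of_mem_disc hη0 hη ha0 ha (hmem w hw)
    refine (norm_LFunction_le_hybrid χ hχ hη0 hη hwre).trans ?_
    have hexpM : Real.exp M = Real.exp 1 * Real.exp 1 * (q : ℝ) ^ η * (|t| + 2) *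
        (Real.log q + 5) := by
      rw [hM, Real.exp_add, Real.exp_add, Real.exp_add, Real.exp_log (by positivity),
        Real.exp_log (by linarith), Real.rpow_def_of_pos hq0,
        show (2 : ℝ) = 1 + 1 by norm_num, Real.exp_add, mul_comm (Real.log q) η]
    rw [hexpM]
    have he1 : 1 ≤ Real.exp 1 := Real.one_le_exp zero_le_one
    have hqη : 0 ≤ (q : ℝ) ^ η := Real.rpow_nonneg hq0.le _
    calc Real.exp 1 * (q : ℝ) ^ η * ‖w‖ * (Real.log q + 5)
        ≤ Real.exp 1 * (q : ℝ) ^ η * (|t| + 2) * (Real.log q + 5) := by gcongr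
      _ = 1 * Real.exp 1 * (q : ℝ) ^ η * (|t| + 2) * (Real.log q + 5) := by ring
      _ ≤ Real.exp 1 * Real.exp 1 * (q : ℝ) ^ η * (|t| + 2) * (Real.log q + 5) := by gcongr
  -- Borel–Carathéodory, translated to the origin
  set f₀ : ℂ → ℂ := fun z ↦ Lg (c + z) with hf₀
  have hshift : ∀ z ∈ ball (0 : ℂ) R, c + z ∈ ball c R := by
    intro z hz
    rw [mem_ball_zero_iff] at hz
    rwa [mem_ball, dist_eq_norm, add_sub_cancel_left]
  have hf₀d : DifferentiableOn ℂ f₀ (ball 0 R) := by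
    intro z hz
    exact ((hLd.differentiableAt (isOpen_ball.mem_nhds (hshift z hz))).comp z
      ((differentiableAt_const c).add differentiableAt_id)).differentiableWithinAt
  have hmaps : MapsTo f₀ (ball 0 R) {z | z.re ≤ M} := by
    intro z hz
    have hcz := hshift z hz
    show (Lg (c + z)).re ≤ M
    have hre : (Lg (c + z)).re = Real.log ‖χ.LFunction (c + z)‖ := by
      rw [← hexp _ hcz, norm_exp, Real.log_exp]
    rw [hre]
    have hpos : 0 < ‖χ.LFunction (c + z)‖ := norm_pos_iff.mpr (hf0 _ hcz)
    calc Real.log ‖χ.LFunction (c + z)‖ ≤ Real.log (Real.exp M) :=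
          Real.log_le_log hpos (hbound _ hcz)
      _ = M := Real.log_exp M
  have hz : s - c ∈ ball (0 : ℂ) R := by rwa [mem_ball_zero_iff]
  have key := borelCaratheodory hM0 hf₀d hmaps hR0 hz
  have hf₀s : f₀ (s - c) = Lg s := by simp [hf₀]
  have hf₀0 : f₀ 0 = log (χ.LFunction c) := by simp only [hf₀, add_zero]; exact hLc
  rw [hf₀s, hf₀0] at key
  -- the centre: `‖log L(s₀, χ)‖ ≤ log(2/(aη)) + π`
  have hcre : c.re = 1 + a * η := by simp [hc]
  have haη0 : 0 < a * η := by positivity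
  have haη1 : a * η ≤ 1 := by nlinarith
  have hlogc : ‖log (χ.LFunction c)‖ ≤ Real.log (2 / (a * η)) + Real.pi := by
    refine (norm_le_abs_re_add_abs_im _).trans (add_le_add ?_ ?_)
    · rw [Complex.log_re]
      refine (abs_log_norm_LFunction_le χ (by rw [hcre]; linarith)).trans ?_
      rw [hcre, add_sub_cancel_left]
      refine Real.log_le_log (by positivity) ?_
      rw [div_le_div_iff₀ haη0 haη0]
      nlinarith
    · exact abs_le.2 ⟨(neg_pi_lt_log_im _).le, log_im_le_pi _⟩
  -- `‖L⁻¹‖ = exp(−Re Lg) ≤ exp ‖Lg‖`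
  have hsc : s ∈ ball c R := by rw [mem_ball, dist_eq_norm]; exact hs
  have hinv : ‖(χ.LFunction s)⁻¹‖ = Real.exp (-(Lg s).re) := by
    rw [← hexp s hsc, ← Complex.exp_neg, norm_exp, neg_re]
  rw [hinv, Real.exp_le_exp]
  have h1 : -(Lg s).re ≤ ‖Lg s‖ := by
    have := abs_re_le_norm (Lg s); have := neg_abs_le (Lg s).re; linarith
  refine h1.trans (key.trans ?_)
  have hd : ‖s - c‖ < R := hs
  have hden : 0 < R - ‖s - c‖ := by linarith
  have hnum : 0 ≤ R + ‖s - c‖ := by positivity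
  have h2 : ‖log (χ.LFunction c)‖ * (R + ‖s - c‖) / (R - ‖s - c‖) ≤
      (Real.log (2 / (a * η)) + Real.pi) * (R + ‖s - c‖) / (R - ‖s - c‖) :=
    div_le_div_of_nonneg_right (mul_le_mul_of_nonneg_right hlogc hnum) hden.le
  linarith

/-- **On the horizontal line through the centre.** Under the hypotheses of
`norm_inv_LFunction_le_exp` with `a ≤ 1/4`, for `1 − η/2 ≤ σ ≤ 1 + aη`:
`‖L(σ + it, χ)⁻¹‖ ≤ exp( 4M(1 + aη − σ)/η + 4(log(2/(aη)) + π) )`,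
`M = 2 + η log q + log(|t| + 2) + log(log q + 5)` (here `d = 1 + aη − σ`, `R − d ≥ η/2`,
`R + d ≤ 2η`). The exponent is affine in `σ`, with slope `−4M/η`; against it, `x^σ` decays like
`x^{-(1 + aη − σ)}`, which wins as soon as `log x > 4M/η` — Linnik's mechanism.
[cite: Titchmarsh1986, §3.11 (proof of Theorem 3.11)] -/
theorem norm_inv_LFunction_le_exp_of_line (hχ : χ ≠ 1) {η a t : ℝ} (hη0 : 0 < η) (hη : η ≤ 1 / 4)
    (ha0 : 0 < a) (ha : a ≤ 1 / 4)
    (hzero : ∀ w : ℂ, ‖w - (1 + a * η + t * I)‖ < (1 + a) * η → w.re < 1 → χ.LFunction w ≠ 0)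
    {σ : ℝ} (hσ1 : 1 - η / 2 ≤ σ) (hσ2 : σ ≤ 1 + a * η) :
    ‖(χ.LFunction (σ + t * I))⁻¹‖ ≤ Real.exp
      (4 * (2 + η * Real.log q + Real.log (|t| + 2) + Real.log (Real.log q + 5)) *
          (1 + a * η - σ) / η + 4 * (Real.log (2 / (a * η)) + Real.pi)) := by
  have hq1 : (1 : ℝ) ≤ q := by exact_mod_cast NeZero.one_le
  have hlogq : 0 ≤ Real.log q := Real.log_nonneg hq1
  set M : ℝ := 2 + η * Real.log q + Real.log (|t| + 2) + Real.log (Real.log q + 5) with hM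
  have hlt2 : 0 < Real.log (|t| + 2) := Real.log_pos (by linarith [abs_nonneg t])
  have hlq5 : 0 < Real.log (Real.log q + 5) := Real.log_pos (by linarith)
  have hM0 : 0 < M := by have := mul_nonneg hη0.le hlogq; positivity
  -- the distance to the centre
  have hd : ‖(σ + t * I : ℂ) - (1 + a * η + t * I)‖ = 1 + a * η - σ := by
    have : (σ + t * I : ℂ) - (1 + a * η + t * I) = ((σ - (1 + a * η) : ℝ) : ℂ) := by
      push_cast; ring
    rw [this, Complex.norm_real, Real.norm_eq_abs, abs_of_nonpos (by linarith)]
    ring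
  have hdR : 1 + a * η - σ < (1 + a) * η := by nlinarith
  have h := norm_inv_LFunction_le_exp χ hχ hη0 hη ha0 (by linarith) hzero
    (s := σ + t * I) (by rw [hd]; exact hdR)
  rw [hd] at h
  refine h.trans ?_
  rw [Real.exp_le_exp]
  have haη0 : 0 < a * η := by positivity
  have haη1 : a * η ≤ 1 := by nlinarith
  have hc0 : 0 ≤ Real.log (2 / (a * η)) + Real.pi := by
    have : 0 ≤ Real.log (2 / (a * η)) := Real.log_nonneg (by rw [le_div_iff₀ haη0]; linarith)
    positivity
  have hden : η / 2 ≤ (1 + a) * η - (1 + a * η - σ) := by nlinarith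
  have hden0 : 0 < (1 + a) * η - (1 + a * η - σ) := by linarith
  have hnum : (1 + a) * η + (1 + a * η - σ) ≤ 2 * η := by nlinarith
  have hdd : 0 ≤ 1 + a * η - σ := by linarith
  refine add_le_add ?_ ?_
  · rw [div_le_div_iff₀ hden0 hη0]
    have h0 : 0 ≤ 2 * M * (1 + a * η - σ) := by positivity
    nlinarith
  · rw [mul_div_assoc]
    refine mul_comm (4 : ℝ) _ ▸ mul_le_mul_of_nonneg_left ?_ hc0
    rw [div_le_iff₀ hden0]
    nlinarith

end InvLFunctionDisc

end Literature.NumberTheory.LFunctions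

end
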